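import Mathlib
import Summits.NavierStokesRegularity.NavierStokesRegularity.Theorems.EulerZoomLiouvillePowerGaugeEulerLiouvilleKillingRotation
import Summits.NavierStokesRegularity.NavierStokesRegularity.Theorems.EulerZoomLiouvillePowerGaugeEulerLiouvilleGalileanHarmonicShear
import Summits.NavierStokesRegularity.NavierStokesRegularity.Theorems.CoriolisHeadTypeIRateTransport
import Summits.NavierStokesRegularity.NavierStokesRegularity.Theorems.EulerZoomLiouvillePowerGaugeEulerLiouvilleSpacePeriodic
import HarnessLib

/-!
# A PROFILE INVARIANT UNDER A GENUINE SCREW MOTION AND WITH SUB-VOLUME GROWTH VANISHES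
# (crux `EulerZoomLiouville.PowerGaugeEulerLiouville` = stmt-NavierStokesRegularity-19832; «E(3)-steady, escaping» stratum, kill of case (ii); width seat ns-ezl-w3 g5)

Route №10 `EulerZoomLiouville`, crux E.  Output shape of `RigidFrame.killing_invariance` / `Killing.screwShearVanishes`: a profile `U` with
`exp(−θB) U(exp(θB) z + θ b) = U(z)` a.e. for every `θ` (`B` skew, `Bb = 0`).  If the PITCH `b` is non-zero, `U` VANISHES under the `A`-gauge slice growth
`∫⁻_{B_R}‖U‖² ≤ C R^{m}`, `m < 1` (`RigidFrame.screwInvariant_ae_eq_zero`): `|U|²` has equal masses on the balls `B(kθ₁ b, r)` along the axis (the screw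
maps `B(0, r)` onto them — a rotation about `0` followed by the translation `θ b`), `n` of them are disjoint and sit in `B(0, nθ₁‖b‖ + r)`, so
`n I ≤ C′ n^{max(m,0)}` and `I = 0`.  The a.e. packing is `RigidFrame.mul_ball_le_of_mass_eq` (the twin of `SpacePeriodic.mul_sliceBall_le` /
`FrozenDirection.mul_sliceBall_le_of_ae` with EQUAL BALL MASSES as the only hypothesis).  Case (i) (`B = 0`, pure translation) is the same statement; the
rotation case `b = 0` is NOT killed (axisymmetric profiles).

WHAT THIS IS NOT: not NS regularity, not the crux E — a stratum tool of the crux CLASS 19832 (MODEL lattice; E/NS strata), `--supports` stmt-19832;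
19832 OPEN. [folklore]
-/

noncomputable section

-- flat `Theorems/<Route><Decl>…` files of one crux share the namespace of the crux (tree convention: `Summit.<S>.<S>.…`)
set_option linter.dupNamespace false

open MeasureTheory Set Filter Topology Metric Function TopologicalSpace InnerProductSpace
open scoped ENNReal NNReal RealInnerProductSpace

namespace Summit.NavierStokesRegularity.NavierStokesRegularity.Theorems.PowerGaugeEulerLiouville

namespace RigidFrame

open Literature.Analysis Literature.Analysis.FunctionSpaces Literature.Analysis.FluidPDE
open Summit.NavierStokesRegularity.NavierStokesRegularity.Theorems.CoriolisHead
open Summit.NavierStokesRegularity.NavierStokesRegularity.Theorems.PowerGaugeEulerLiouville.GalileanFrames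
open Summit.NavierStokesRegularity.NavierStokesRegularity.Theorems.PowerGaugeEulerLiouville.Killing

/-- **`n` disjoint balls of equal mass carry `n` times the mass**: if `∫_{B(k w, R)} g = ∫_{B(0, R)} g` for every `k : ℕ` and `‖w‖ ≥ 2R`, then
`n · ∫_{B(0,R)} g ≤ ∫_{⋃_{k<n} B(k w, R)} g`. [folklore] -/
theorem mul_ball_le_of_mass_eq (g : EuclideanSpace ℝ (Fin 3) → ℝ≥0∞) {w : EuclideanSpace ℝ (Fin 3)} {R : ℝ}
    (hmass : ∀ k : ℕ, ∫⁻ x in ball ((k : ℝ) • w) R, g x = ∫⁻ x in ball (0 : EuclideanSpace ℝ (Fin 3)) R, g x)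
    (hw : 2 * R ≤ ‖w‖) (n : ℕ) :
    (n : ℝ≥0∞) * ∫⁻ x in ball (0 : EuclideanSpace ℝ (Fin 3)) R, g x ≤
      ∫⁻ x in ⋃ k ∈ Finset.range n, ball ((k : ℝ) • w) R, g x := by
  -- adapted from the tree's `FrozenDirection.mul_sliceBall_le_of_ae`
  induction n with
  | zero => simp
  | succ n ih =>
    have hdisj : Disjoint (⋃ k ∈ Finset.range n, ball ((k : ℝ) • w) R) (ball ((n : ℝ) • w) R) := by
      refine disjoint_iUnion₂_left.2 fun k hk => ?_
      have hk' : (k : ℝ) + 1 ≤ n := by exact_mod_cast Finset.mem_range.1 hk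
      refine ball_disjoint_ball ?_
      rw [dist_eq_norm, ← sub_smul, norm_smul, Real.norm_eq_abs, abs_sub_comm,
        abs_of_nonneg (by linarith)]
      nlinarith [norm_nonneg w]
    rw [Finset.range_add_one, Finset.set_biUnion_insert, union_comm,
      lintegral_union measurableSet_ball hdisj, hmass n]
    calc (((n + 1 : ℕ) : ℝ≥0∞)) * ∫⁻ x in ball (0 : EuclideanSpace ℝ (Fin 3)) R, g x
        = (n : ℝ≥0∞) * (∫⁻ x in ball (0 : EuclideanSpace ℝ (Fin 3)) R, g x) +
            ∫⁻ x in ball (0 : EuclideanSpace ℝ (Fin 3)) R, g x := by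
          push_cast; ring
      _ ≤ (∫⁻ x in ⋃ k ∈ Finset.range n, ball ((k : ℝ) • w) R, g x) +
            ∫⁻ x in ball (0 : EuclideanSpace ℝ (Fin 3)) R, g x := add_le_add ih le_rfl

/-- **Screw-invariant densities have equal ball masses along the axis**: if `g(exp(θB) z + θ b) = g(z)` a.e. for every `θ` (`B` skew), then
`∫_{B(θ b, r)} g = ∫_{B(0, r)} g`. [folklore] -/
theorem setLIntegral_ball_axis_eq {B : EuclideanSpace ℝ (Fin 3) →L[ℝ] EuclideanSpace ℝ (Fin 3)}
    (hB : ∀ x : EuclideanSpace ℝ (Fin 3), ⟪B x, x⟫ = 0) {b : EuclideanSpace ℝ (Fin 3)} {g : EuclideanSpace ℝ (Fin 3) → ℝ≥0∞}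
    (hinv : ∀ θ : ℝ, (fun z => g (NormedSpace.exp (θ • B) z + θ • b)) =ᵐ[volume] g) (θ : ℝ) (r : ℝ) :
    ∫⁻ x in ball (θ • b) r, g x = ∫⁻ x in ball (0 : EuclideanSpace ℝ (Fin 3)) r, g x := by
  rw [← setLIntegral_ball_comp_add_right g (θ • b) r,
    ← setLIntegral_ball_comp_expSkew hB θ (fun y => g (y + θ • b)) r]
  exact lintegral_congr_ae (ae_restrict_of_ae (hinv θ))

/-- **A PROFILE INVARIANT UNDER A GENUINE SCREW MOTION VANISHES UNDER SUB-VOLUME GROWTH.**  `U` a.e.-strongly measurable with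
`∫⁻_{B_R}‖U‖² ≤ C R^{m}` for `R ≥ 1`, `m < 1`; `B` skew, `b ≠ 0`, and `exp(−θB) U(exp(θB) z + θ b) = U(z)` a.e. for every `θ`.  Then `U = 0` a.e.
(For `B = 0` this is invariance under the translations `θ b`.) [folklore] -/
theorem screwInvariant_ae_eq_zero {U : EuclideanSpace ℝ (Fin 3) → EuclideanSpace ℝ (Fin 3)}
    {B : EuclideanSpace ℝ (Fin 3) →L[ℝ] EuclideanSpace ℝ (Fin 3)} {b : EuclideanSpace ℝ (Fin 3)} {C m : ℝ}
    (hB : ∀ x : EuclideanSpace ℝ (Fin 3), ⟪B x, x⟫ = 0) (hb0 : b ≠ 0) (hm : m < 1) (hUm : AEStronglyMeasurable U volume)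
    (hgrow : ∀ R : ℝ, 1 ≤ R → ∫⁻ z in ball (0 : EuclideanSpace ℝ (Fin 3)) R, ‖U z‖ₑ ^ 2 ≤ ENNReal.ofReal (C * R ^ m))
    (hinv : ∀ θ : ℝ, (fun z => NormedSpace.exp ((-θ) • B) (U (NormedSpace.exp (θ • B) z + θ • b))) =ᵐ[volume] U) :
    U =ᵐ[volume] 0 := by
  set g₂ : EuclideanSpace ℝ (Fin 3) → ℝ≥0∞ := fun x => ‖U x‖ₑ ^ 2 with hg₂
  -- `|U|²` is screw invariant a.e.
  have hginv : ∀ θ : ℝ, (fun z => g₂ (NormedSpace.exp (θ • B) z + θ • b)) =ᵐ[volume] g₂ := by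
    intro θ
    filter_upwards [hinv θ] with z hz
    have h1 : ‖NormedSpace.exp ((-θ) • B) (U (NormedSpace.exp (θ • B) z + θ • b))‖ = ‖U (NormedSpace.exp (θ • B) z + θ • b)‖ :=
      TypeIRate.norm_exp_smul_skew hB (-θ) _
    simp only [hg₂]
    rw [← ofReal_norm, ← ofReal_norm, ← h1, hz]
  -- ### every ball has zero energy
  have hball : ∀ R : ℝ, 0 < R → ∫⁻ x in ball (0 : EuclideanSpace ℝ (Fin 3)) R, g₂ x = 0 := by
    intro R hR
    set I : ℝ≥0∞ := ∫⁻ x in ball (0 : EuclideanSpace ℝ (Fin 3)) R, g₂ x with hI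
    set ℓ : ℝ := 2 * R + 1 with hℓ
    have hℓ1 : 1 ≤ ℓ := by rw [hℓ]; linarith
    have hℓ0 : 0 < ℓ := by linarith
    have hb0' : 0 < ‖b‖ := norm_pos_iff.2 hb0
    set θ₁ : ℝ := ℓ / ‖b‖ with hθ₁
    set w : EuclideanSpace ℝ (Fin 3) := θ₁ • b with hw
    have hnw : ‖w‖ = ℓ := by
      rw [hw, norm_smul, Real.norm_of_nonneg (by positivity), hθ₁, div_mul_cancel₀ ℓ hb0'.ne']
    have hw2 : 2 * R ≤ ‖w‖ := by rw [hnw, hℓ]; linarith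
    have hmass : ∀ k : ℕ, ∫⁻ x in ball ((k : ℝ) • w) R, g₂ x = ∫⁻ x in ball (0 : EuclideanSpace ℝ (Fin 3)) R, g₂ x := by
      intro k
      have h := setLIntegral_ball_axis_eq hB hginv ((k : ℝ) * θ₁) R
      rwa [hw, smul_smul]
    set m' : ℝ := max m 0 with hm'
    have hm'0 : 0 ≤ m' := le_max_right _ _
    have hm'1 : m' < 1 := max_lt hm one_pos
    set K' : ℝ := max C 0 with hK'
    have hK'0 : 0 ≤ K' := le_max_right _ _
    set A : ℝ := K' * (ℓ + R) ^ m' with hA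
    have hA0 : 0 ≤ A := by positivity
    have hpack : ∀ n : ℕ, 1 ≤ n → (n : ℝ≥0∞) * I ≤ ENNReal.ofReal (A * (n : ℝ) ^ m') := by
      intro n hn
      have hn1 : (1 : ℝ) ≤ n := by exact_mod_cast hn
      set r : ℝ := (n : ℝ) * ‖w‖ + R with hr
      have hr1 : 1 ≤ r := by rw [hr, hnw]; nlinarith
      have hr0 : 0 < r := by linarith
      calc (n : ℝ≥0∞) * I ≤ ∫⁻ x in ⋃ k ∈ Finset.range n, ball ((k : ℝ) • w) R, g₂ x :=
            mul_ball_le_of_mass_eq g₂ hmass hw2 n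
        _ ≤ ∫⁻ x in ball (0 : EuclideanSpace ℝ (Fin 3)) r, g₂ x := lintegral_mono_set (SpacePeriodic.iUnion_ball_subset n)
        _ ≤ ENNReal.ofReal (C * r ^ m) := hgrow r hr1
        _ ≤ ENNReal.ofReal (A * (n : ℝ) ^ m') := by
            refine ENNReal.ofReal_le_ofReal ?_
            have h1 : C * r ^ m ≤ K' * r ^ m := mul_le_mul_of_nonneg_right (le_max_left _ _) (Real.rpow_nonneg hr0.le _)
            have h2 : r ^ m ≤ r ^ m' := Real.rpow_le_rpow_of_exponent_le hr1 (le_max_left _ _)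
            have h3 : r ≤ (ℓ + R) * n := by rw [hr, hnw]; nlinarith
            have h4 : r ^ m' ≤ ((ℓ + R) * n) ^ m' := Real.rpow_le_rpow hr0.le h3 hm'0
            have h5 : ((ℓ + R) * (n : ℝ)) ^ m' = (ℓ + R) ^ m' * (n : ℝ) ^ m' :=
              Real.mul_rpow (by positivity) (by positivity)
            calc C * r ^ m ≤ K' * r ^ m := h1
              _ ≤ K' * r ^ m' := mul_le_mul_of_nonneg_left h2 hK'0
              _ ≤ K' * ((ℓ + R) * n) ^ m' := mul_le_mul_of_nonneg_left h4 hK'0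
              _ = A * (n : ℝ) ^ m' := by rw [h5, hA]; ring
    refine le_antisymm (ENNReal.le_of_forall_pos_le_add fun δ hδ _ => ?_) zero_le
    rw [zero_add]
    have htend : Tendsto (fun x : ℝ => A * x ^ (m' - 1)) atTop (𝓝 (A * 0)) := by
      refine tendsto_const_nhds.mul ?_
      have := tendsto_rpow_neg_atTop (y := 1 - m') (by linarith)
      simpa [show -(1 - m') = m' - 1 by ring] using this
    rw [mul_zero] at htend
    have hδ' : (0 : ℝ) < δ := by exact_mod_cast hδ
    obtain ⟨x₀, hx₀⟩ := (htend.eventually (gt_mem_nhds hδ')).exists_forall_of_atTop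
    obtain ⟨n, hn⟩ := exists_nat_ge (max x₀ 1)
    have hn1 : 1 ≤ n := by exact_mod_cast (le_max_right x₀ 1).trans hn
    have hnx : x₀ ≤ (n : ℝ) := (le_max_left _ _).trans hn
    have hn0 : (0 : ℝ) < n := by exact_mod_cast hn1
    have hlt : A * (n : ℝ) ^ (m' - 1) < δ := hx₀ n hnx
    have hdiv : I ≤ ENNReal.ofReal (A * (n : ℝ) ^ m') / (n : ℝ≥0∞) := by
      rw [ENNReal.le_div_iff_mul_le (Or.inl (Nat.cast_ne_zero.2 (Nat.one_le_iff_ne_zero.1 hn1)))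
        (Or.inl (ENNReal.natCast_ne_top n)), mul_comm]
      exact hpack n hn1
    calc I ≤ ENNReal.ofReal (A * (n : ℝ) ^ m') / (n : ℝ≥0∞) := hdiv
      _ = ENNReal.ofReal (A * (n : ℝ) ^ (m' - 1)) := by
          rw [← ENNReal.ofReal_natCast, ← ENNReal.ofReal_div_of_pos hn0]
          congr 1
          rw [Real.rpow_sub_one hn0.ne', mul_div_assoc]
      _ ≤ (δ : ℝ≥0∞) := by
          rw [← ENNReal.ofReal_coe_nnreal]; exact ENNReal.ofReal_le_ofReal hlt.le
  -- ### hence `U = 0` a.e.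
  have hball_ae : ∀ n : ℕ, ∀ᵐ y ∂(volume.restrict (ball (0 : EuclideanSpace ℝ (Fin 3)) ((n : ℝ) + 1))), U y = 0 := by
    intro n
    have h := hball ((n : ℝ) + 1) (by positivity)
    rw [lintegral_eq_zero_iff' (hUm.restrict.enorm.pow_const 2)] at h
    filter_upwards [h] with y hy
    simpa [hg₂] using hy
  have hunion : (⋃ n : ℕ, ball (0 : EuclideanSpace ℝ (Fin 3)) ((n : ℝ) + 1)) = univ := by
    refine eq_univ_of_forall fun y => mem_iUnion.2 ?_
    obtain ⟨n, hn⟩ := exists_nat_gt ‖y‖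
    exact ⟨n, by rw [mem_ball, dist_zero_right]; linarith⟩
  have h := (ae_restrict_iUnion_iff (μ := (volume : Measure (EuclideanSpace ℝ (Fin 3))))
    (fun n : ℕ => ball (0 : EuclideanSpace ℝ (Fin 3)) ((n : ℝ) + 1)) (fun y => U y = 0)).2 hball_ae
  rw [hunion, Measure.restrict_univ] at h
  exact h

end RigidFrame

end Summit.NavierStokesRegularity.NavierStokesRegularity.Theorems.PowerGaugeEulerLiouville

end
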